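import Summits.ABC.IUTFork.Repair.RHSigmaMassMu
import HarnessLib

/-!
# R-H ROUND 2, EXPONENT PROGRAMME (EXP-SPEC §0): [MU-C] IN MASS-FRACTION CURRENCY AT THE GENUINE DATUM — `OffSigmaTolerance (1−μ₀) A T (B_triv(σᶜ))`
# ⟺ `μ₀·T.gap − A ≤ mass(σ)`; discharged at `μ₀ := μ(T)` for free; the `σ = ∅` junk band; `μ(T)` explicit; uniform licensed depth `J ⟹ μ₀ = S(J)/S(l⋇)`

abc-iut cell, rung LADDER-ABC:A2.RESCUE.H; R-H ROUND 2 seat abc-iut-rh2-w-1 (GEN 2; Q1′ WEIGHTS typer, kernel side); companion of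
`Repair/RHSigmaMassMu.lean` (generic + bed arithmetic of `μ = mass(σ)/M`). PROOF-ONLY (0 definitions, 0 `Prop` facts). rh-lead g2's EXP-SPEC v0
(2026-08-27T00:58Z) F5 `Conditional.SigmaMass.abcExp_of_licenceOn_mu_content_hregC (μ₀)` takes [MU-C] = abc-iut-rh2-xi-1's
`RH.OffSigma.OffSigmaTolerance (1−μ₀) (SigmaMass.tol P l) T (offTrivialMass … σ)` VERBATIM («`B_triv(σᶜ)(T) ≤ (1−μ₀)·M(T) + Tol(P,l)`»). This file states,
BY NAME in that predicate and in abc-iut-rh2-T-1's `RH.SigmaMass.onTrivialMass / offTrivialMass / totalTrivialMass` (p477034/p478609), at a genuine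
Θ-volume datum `T` of `(P, l)` with abc-iut-c312-7's sharp setting over `T.K` at `pilotDataOfK T.D T.K` and the CHOSEN realising ideles (the bed of
`Conditional.SigmaMass.cor312UpTo_offTrivialMass_of_licenceOn_chosen`, p477354; `M = T.gap` there, p478601 `totalTrivialMass_chosen_eq_gap`):
* §1 GENERIC (any `Cor312.Setting`, `BridgeHyps`; `mass(σ)` is MONOTONE in `σ` — abc-iut-rh-typ-3's `RHHullCapacityNecessaryMassCeiling.onTrivialMass_mono`,
  cited not restated): one cell `c ∈ σ` gives `mass(σ) ≥ cost(c)/l⋇`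
  (`cellTrivialCost_div_le_onTrivialMass`, positivity certificate for `μ > 0`); `0 ≤ mass(σ)/M ≤ 1`; [MU-C]'s ALGEBRA
  `B_triv(σᶜ) ≤ κ·M + A ⟺ (1−κ)·M − A ≤ mass(σ)` (`offTrivialMass_le_iff_onTrivialMass_ge`), `μ₀·M ≤ mass(σ) ∧ A ≥ 0 ⟹ B_triv(σᶜ) ≤ (1−μ₀)·M + A`
  (`offTrivialMass_le_of_le_onTrivialMass`) and the FREE instance `μ₀ := mass(σ)/M` (`offTrivialMass_le_massFrac`);
* §2 AT THE DATUM, for EVERY stratum `σ` and reals `κ, A, μ₀`: **`OffSigmaTolerance κ A T (B_triv(σᶜ)) ⟺ (1−κ)·T.gap − A ≤ mass(σ)`**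
  (`offSigmaTolerance_offTrivialMass_iff_chosen` — EXP-SPEC §0's «⟺ mass(σ) ≥ μ₀·M − Tol»); **[MU-C] from `μ₀·T.gap ≤ mass(σ)`**
  (`offSigmaTolerance_offTrivialMass_of_le_onTrivialMass_chosen`); **[MU-C] at `μ₀ := μ(T) := mass(σ)/T.gap` HOLDS FOR FREE, `0 ≤ μ(T) ≤ 1`**
  (`offSigmaTolerance_offTrivialMass_massFrac_chosen` — at each datum the binder is inhabited at the datum's own mass fraction; the content question is its size);
  **the `σ = ∅` JUNK BAND `OffSigmaTolerance (1−μ₀) A T (B_triv(∅ᶜ)) ⟺ μ₀·T.gap ≤ A`** (`offSigmaTolerance_offTrivialMass_empty_iff_chosen` — abc-iut-rh2-ref-3's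
  «μ₀-family sanity» 2026-08-27T00:56:16Z as a kernel iff: with `A = Tol(P,l)` the empty stratum passes exactly for `log q` below `Tol/(μ₀·((l+1)/24 − 1/(2l)))`);
  **`μ(T)` EXPLICIT**: for a label-segment `σ` (`plan/rescue/R-H/SLICE.md`), `mass(σ) = (1/l⋇)·Σᶠ_{v_ℚ} S(j₀(v_ℚ))·h(v_ℚ)` with `h(p) = (1/[K:ℚ])·Σ_{w | p} P_q(w)·log N(w)`,
  `h(∞) = 0`, `S(k) = k(k−1)(2k+5)/6` (`onTrivialMass_chosen_labelSegment_eq`; `T.gap = (S(l⋇)/l⋇)·Σᶠ h` by the companion's bed identity + p478601) —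
  **`μ(T) = Σ_p S(j₀(p))·h_p / (S(l⋇)·Σ_p h_p)`**; and the CERTIFICATE **uniform licensed depth `J` at every bad packet ⟹ [MU-C] with `μ₀ := S(J)/S(l⋇)`**
  for every `A ≥ 0` (`offSigmaTolerance_offTrivialMass_of_segment_subset_chosen`; `≥ ((J−1)/(l⋇+1))³`, `RHSigmaMassMu.sqSubOneSum_frac_ge_cubic`).
HONEST FRAMING: identities/inequalities about OUR typed quantities at the genuine bed; nothing here asserts that abc is proved or refuted, or that [IUTchIII]
Cor. 3.12 holds or fails at any datum, or takes a side on any author; [MU-C]/[LIC-C]/[CONE-C] stay HYPOTHESES of F5 (R14′ content cut); «inhabited at `μ(T)`»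
≠ licence content — whether genuine data supply `μ(T) ≥ μ₀ > 0` uniformly on the content locus is OPEN (EXP-SPEC §4, Q3); typed ≠ proved; computed ≠ proved.
[claim: Mochizuki2012, status: disputed] for every IUT locution. [cite: Mochizuki2012, IUTchIII Cor. 3.12 p. 173–174, Prop. 3.9 (i)–(iii) p. 116–117; IUTchIV
Thm. 1.10 p. 23, Step (v) p. 27–29, Steps (viii)–(x) p. 30–32; Cor. 2.2 (ii) p. 46] [cite: DupuyHilado2025, §3.3, Thm. 3.10.1]
-/

noncomputable section

open Set Function NumberField IsDedekindDomain

namespace Summit.ABC.IUTFork.Repair.RH.CellWeights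

open Summit.ABC.IUTFork.Thm311 Summit.ABC.IUTFork.Thm311.Real Summit.ABC.IUTFork.Cor312 Summit.ABC.IUTFork.Cor312.Setting
  Summit.ABC.IUTFork.Cor312Vol Summit.ABC.IUTFork.Cor312Prov Literature.IUT.LogThetaLattice Literature.IUT.LogVolume
  Literature.IUT.HodgeTheaters Literature.IUT.LogVolume.ThetaData Literature.NumberTheory.DiophantineGeometry.GenEll
  Summit.ABC.IUTFork.Repair.RH.SigmaLicence Summit.ABC.IUTFork.Repair.RH.SigmaStrataEq Summit.ABC.IUTFork.Repair.RH.SigmaMass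
  Summit.ABC.IUTFork.Repair.RH.OffSigma Summit.ABC.IUTFork.Conditional

/-! ## §1. Generic, rh2-T-1's vocabulary: the single-cell lower bound, `μ ∈ [0,1]`, and [MU-C]'s algebra -/

section GenericSigma

variable {ι : ThetaIndex} {S : Situation ι} {P : Cor312.Setting S}

/-- **A single cell `c ∈ σ` already gives `mass(σ) ≥ cost(c)/l⋇`** (mirror of rh2-T-1's `cellTrivialCost_div_le_offTrivialMass`): the POSITIVITY
certificate for `μ = mass(σ)/M > 0` — one licensed cell of positive trivial cost (a prime cell `(j, p)`, `j ≥ 2`, over a bad place) suffices. [folklore] -/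
theorem cellTrivialCost_div_le_onTrivialMass (H : BridgeHyps P) {σ : Set (Fin ι.lstar × ι.VQ)} {c : Fin ι.lstar × ι.VQ} (hc : c ∈ σ) :
    cellTrivialCost P c / ι.lstar ≤ onTrivialMass P σ := by
  unfold onTrivialMass processionNormalized
  refine div_le_div_of_nonneg_right ?_ (Nat.cast_nonneg _)
  have h1 : cellTrivialCost P c ≤ ∑ᶠ vQ : ι.VQ, σ.indicator (cellTrivialCost P) (c.1, vQ) := by
    have h := single_le_finsum c.2 (indicator_cellTrivialCost_support_finite H σ c.1)
      (fun vQ => Set.indicator_nonneg (fun _ _ => cellTrivialCost_nonneg _) _)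
    rwa [Set.indicator_of_mem hc] at h
  refine h1.trans ?_
  exact Finset.single_le_sum (f := fun i : Fin ι.lstar => ∑ᶠ vQ : ι.VQ, σ.indicator (cellTrivialCost P) (i, vQ))
    (fun i _ => finsum_nonneg fun _ => Set.indicator_nonneg (fun _ _ => cellTrivialCost_nonneg _) _) (Finset.mem_univ c.1)

/-- **`0 ≤ μ`**: the mass fraction `mass(σ)/M` is non-negative. [folklore] -/
theorem onTrivialMass_div_totalTrivialMass_nonneg (σ : Set (Fin ι.lstar × ι.VQ)) :
    0 ≤ onTrivialMass P σ / totalTrivialMass P :=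
  div_nonneg (onTrivialMass_nonneg σ) totalTrivialMass_nonneg

/-- **`μ ≤ 1`**: the mass fraction `mass(σ)/M` is at most one (`mass(σ) ≤ M`, rh2-T-1 `onTrivialMass_le_totalTrivialMass`). [folklore] -/
theorem onTrivialMass_div_totalTrivialMass_le_one (H : BridgeHyps P) (σ : Set (Fin ι.lstar × ι.VQ)) :
    onTrivialMass P σ / totalTrivialMass P ≤ 1 :=
  div_le_one_of_le₀ (onTrivialMass_le_totalTrivialMass H σ) totalTrivialMass_nonneg

/-- **[MU-C]'s ALGEBRA**: for every stratum `σ` and reals `κ, A`, `B_triv(σᶜ) ≤ κ·M + A ⟺ (1−κ)·M − A ≤ mass(σ)` (`mass(σ) + B_triv(σᶜ) = M`,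
rh2-T-1 `onTrivialMass_add_offTrivialMass`). With `κ = 1 − μ₀`, `A = Tol`: «`B_triv(σᶜ) ≤ (1−μ₀)·M + Tol` ⟺ `mass(σ) ≥ μ₀·M − Tol`» — EXP-SPEC §0's
displayed equivalence. [folklore] -/
theorem offTrivialMass_le_iff_onTrivialMass_ge (H : BridgeHyps P) (σ : Set (Fin ι.lstar × ι.VQ)) (κ A : ℝ) :
    offTrivialMass P σ ≤ κ * totalTrivialMass P + A ↔ (1 - κ) * totalTrivialMass P - A ≤ onTrivialMass P σ := by
  rw [← onTrivialMass_add_offTrivialMass H σ]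
  have e : κ * (onTrivialMass P σ + offTrivialMass P σ) = κ * onTrivialMass P σ + κ * offTrivialMass P σ := mul_add _ _ _
  have e' : (1 - κ) * (onTrivialMass P σ + offTrivialMass P σ) =
      onTrivialMass P σ + offTrivialMass P σ - (κ * onTrivialMass P σ + κ * offTrivialMass P σ) := by ring
  rw [e, e']
  constructor <;> intro h <;> linarith

/-- **[MU-C] from a MASS-FRACTION LOWER BOUND**: `A ≥ 0` and `μ₀·M ≤ mass(σ)` give `B_triv(σᶜ) ≤ (1−μ₀)·M + A`. [folklore] -/
theorem offTrivialMass_le_of_le_onTrivialMass (H : BridgeHyps P) (σ : Set (Fin ι.lstar × ι.VQ)) {μ₀ A : ℝ} (hA : 0 ≤ A)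
    (h : μ₀ * totalTrivialMass P ≤ onTrivialMass P σ) : offTrivialMass P σ ≤ (1 - μ₀) * totalTrivialMass P + A := by
  rw [offTrivialMass_le_iff_onTrivialMass_ge H σ]
  have e : (1 - (1 - μ₀)) * totalTrivialMass P = μ₀ * totalTrivialMass P := by ring
  rw [e]
  linarith

/-- **[MU-C] AT `μ₀ := μ` HOLDS FOR FREE**: with `μ := mass(σ)/M`, `B_triv(σᶜ) ≤ (1−μ)·M + A` for every `A ≥ 0` (both sides equal `B_triv(σᶜ)` up to `A`
when `M ≠ 0`; when `M = 0` everything vanishes). So at each datum the binder is inhabited at the datum's OWN mass fraction — the content question is how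
large that fraction is (§3, and Q3). [folklore] -/
theorem offTrivialMass_le_massFrac (H : BridgeHyps P) (σ : Set (Fin ι.lstar × ι.VQ)) {A : ℝ} (hA : 0 ≤ A) :
    offTrivialMass P σ ≤ (1 - onTrivialMass P σ / totalTrivialMass P) * totalTrivialMass P + A := by
  refine offTrivialMass_le_of_le_onTrivialMass H σ hA ?_
  by_cases hM : totalTrivialMass P = 0
  · rw [hM, mul_zero]
    exact onTrivialMass_nonneg σ
  · rw [div_mul_cancel₀ _ hM]

end GenericSigma

/-! ## §2. At a genuine Θ-volume datum with the CHOSEN realising ideles: [MU-C] by name, `μ(T)` explicit, the junk band, the depth certificate -/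

section Datum

/-- **[MU-C] IN MASS-FRACTION CURRENCY**: at the datum's bed with the chosen ideles, for EVERY stratum `σ` and reals `κ, A`,
`OffSigmaTolerance κ A T (B_triv(σᶜ))` (abc-iut-rh2-xi-1: `B_triv(σᶜ) ≤ κ·T.gap + A`) ⟺ `(1−κ)·T.gap − A ≤ mass(σ)` — with `κ = 1 − μ₀`, `A = Tol(P,l)`
this is EXP-SPEC §0's «[MU-C] ⟺ mass(σ) ≥ μ₀·M − Tol» (`M = T.gap`, p478601). [cite: Mochizuki2012, IUTchIV Thm. 1.10 Steps (viii)–(x) p. 30–32]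
[claim: Mochizuki2012, status: disputed] -/
theorem offSigmaTolerance_offTrivialMass_iff_chosen {P : NFPoint} {l : ℕ} (T : Cor22.ThetaVolumeDatumAt P l) :
    letI := T.instFieldF; letI := T.instNumberFieldF; letI := T.instAlgebraF; letI := T.instFieldK; letI := T.instNumberFieldK; letI := T.instAlgebraK;
        letI := T.instFieldFbar; letI := T.instAlgebraFbar; letI := T.instAlgebraKFbar; letI := T.instIsElliptic;
    ∀ (M : Type) [Field M] [NumberField M]
      (archPk : ∀ (j : (thetaIndex (pilotDataOfK T.D T.K)).Label) (vQ : (thetaIndex (pilotDataOfK T.D T.K)).VQ), Set ((logShellsDH (pilotDataOfK T.D T.K) (analyticLogv T.K)).Packet j vQ))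
      (archSub : ∀ (j : (thetaIndex (pilotDataOfK T.D T.K)).Label) (v : (thetaIndex (pilotDataOfK T.D T.K)).V),
        Set ((logShellsDH (pilotDataOfK T.D T.K) (analyticLogv T.K)).Packet j ((thetaIndex (pilotDataOfK T.D T.K)).over v)))
      (Ψ : ℤ → ∀ v : (thetaIndex (pilotDataOfK T.D T.K)).V, v ∈ (thetaIndex (pilotDataOfK T.D T.K)).Vbad → Set ((logShellsDH (pilotDataOfK T.D T.K) (analyticLogv T.K)).StarPacket v))
      (act : ℤ → ∀ v : (thetaIndex (pilotDataOfK T.D T.K)).V, v ∈ (thetaIndex (pilotDataOfK T.D T.K)).Vbad →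
        (logShellsDH (pilotDataOfK T.D T.K) (analyticLogv T.K)).StarPacket v → Module.End ℚ ((logShellsDH (pilotDataOfK T.D T.K) (analyticLogv T.K)).StarPacket v))
      (Mmod : ℤ → ∀ j : (thetaIndex (pilotDataOfK T.D T.K)).LabelStar, Set ((logShellsDH (pilotDataOfK T.D T.K) (analyticLogv T.K)).GlobalPacket j.1))
      (region : ℤ → ∀ j : (thetaIndex (pilotDataOfK T.D T.K)).LabelStar, FinDivisor M →
        ∀ vQ : (thetaIndex (pilotDataOfK T.D T.K)).VQ, Set ((logShellsDH (pilotDataOfK T.D T.K) (analyticLogv T.K)).Packet j.1 vQ))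
      (n : ℤ) {HT : Type} {LogLink : HT → HT → Type} {IsFull : ∀ {s t : HT}, LogLink s t → Prop} (lat : LGPGaussianLogThetaLattice LogLink IsFull)
      {Frd : Type} {IsoF : Frd → Frd → Type} {Ob : Frd → Type} {realify : Frd → Frd} {Strip : Type} {IsoS : Strip → Strip → Type}
      {Mv : ∀ v : (thetaIndex (pilotDataOfK T.D T.K)).V, v ∈ (thetaIndex (pilotDataOfK T.D T.K)).Vbad → Type} [∀ v h, Monoid (Mv v h)]
      (sig : GlobalLGPFrobenioidSignature (thetaIndex (pilotDataOfK T.D T.K)).lstar (thetaIndex (pilotDataOfK T.D T.K)).V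
        (· ∈ (thetaIndex (pilotDataOfK T.D T.K)).Vbad) Frd IsoF Ob realify Strip IsoS Mv)
      (split : SplittingMonoids Mv) {ObΔ : Type} {N : ∀ v : (thetaIndex (pilotDataOfK T.D T.K)).V, v ∈ (thetaIndex (pilotDataOfK T.D T.K)).Vbad → Type}
      [∀ v h, Monoid (N v h)] (qData : QPilotData ObΔ N)
      (σ : Set (Fin (thetaIndex (pilotDataOfK T.D T.K)).lstar × (thetaIndex (pilotDataOfK T.D T.K)).VQ)) (κ A : ℝ),
      OffSigmaTolerance κ A T (offTrivialMass (settingPrVolSharp (pilotDataOfK T.D T.K) (logvAnalytic_analyticLogv (F := T.K)) M archPk archSub Ψ act Mmod region n lat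
            sig split qData (exists_realising_qIdeles_pilotDataOfK T.D).choose (exists_realising_thetaIdeles_pilotDataOfK T.D).choose
            (exists_realising_qIdeles_pilotDataOfK T.D).choose_spec.1 (exists_realising_qIdeles_pilotDataOfK T.D).choose_spec.2.1) σ) ↔
        (1 - κ) * T.gap - A ≤ onTrivialMass (settingPrVolSharp (pilotDataOfK T.D T.K) (logvAnalytic_analyticLogv (F := T.K)) M archPk archSub Ψ act Mmod region n lat
            sig split qData (exists_realising_qIdeles_pilotDataOfK T.D).choose (exists_realising_thetaIdeles_pilotDataOfK T.D).choose
            (exists_realising_qIdeles_pilotDataOfK T.D).choose_spec.1 (exists_realising_qIdeles_pilotDataOfK T.D).choose_spec.2.1) σ := by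
  intro M _ _ archPk archSub Ψ act Mmod region n HT LogLink IsFull lat Frd IsoF Ob realify Strip IsoS Mv _ sig split ObΔ N _ qData σ κ A
  letI := T.instFieldF; letI := T.instNumberFieldF; letI := T.instAlgebraF; letI := T.instFieldK; letI := T.instNumberFieldK
  letI := T.instAlgebraK; letI := T.instFieldFbar; letI := T.instAlgebraFbar; letI := T.instAlgebraKFbar; letI := T.instIsElliptic
  have H := bridgeHyps_settingPrVolSharp_of_ideles (pilotDataOfK T.D T.K) (logvAnalytic_analyticLogv (F := T.K)) M archPk archSub Ψ act
    Mmod region n lat sig split qData (exists_realising_thetaIdeles_pilotDataOfK T.D).choose (exists_realising_qIdeles_pilotDataOfK T.D).choose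
    (exists_realising_thetaIdeles_pilotDataOfK T.D).choose_spec.1 (exists_realising_thetaIdeles_pilotDataOfK T.D).choose_spec.2.1
    (exists_realising_qIdeles_pilotDataOfK T.D).choose_spec.1 (exists_realising_qIdeles_pilotDataOfK T.D).choose_spec.2.1
  rw [offSigmaTolerance_iff, ← totalTrivialMass_chosen_eq_gap T M archPk archSub Ψ act Mmod region n lat sig split qData]
  exact offTrivialMass_le_iff_onTrivialMass_ge H σ κ A

/-- **[MU-C] FROM A MASS-FRACTION LOWER BOUND**: `A ≥ 0` and `μ₀·T.gap ≤ mass(σ)` (i.e. `μ(T) ≥ μ₀`) give `OffSigmaTolerance (1−μ₀) A T (B_triv(σᶜ))` —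
the form in which a row hand DISCHARGES F5's binder at a datum (`A := SigmaMass.tol P l ≥ 0`, `tol_nonneg`). [claim: Mochizuki2012, status: disputed] -/
theorem offSigmaTolerance_offTrivialMass_of_le_onTrivialMass_chosen {P : NFPoint} {l : ℕ} (T : Cor22.ThetaVolumeDatumAt P l) :
    letI := T.instFieldF; letI := T.instNumberFieldF; letI := T.instAlgebraF; letI := T.instFieldK; letI := T.instNumberFieldK; letI := T.instAlgebraK;
        letI := T.instFieldFbar; letI := T.instAlgebraFbar; letI := T.instAlgebraKFbar; letI := T.instIsElliptic;
    ∀ (M : Type) [Field M] [NumberField M]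
      (archPk : ∀ (j : (thetaIndex (pilotDataOfK T.D T.K)).Label) (vQ : (thetaIndex (pilotDataOfK T.D T.K)).VQ), Set ((logShellsDH (pilotDataOfK T.D T.K) (analyticLogv T.K)).Packet j vQ))
      (archSub : ∀ (j : (thetaIndex (pilotDataOfK T.D T.K)).Label) (v : (thetaIndex (pilotDataOfK T.D T.K)).V),
        Set ((logShellsDH (pilotDataOfK T.D T.K) (analyticLogv T.K)).Packet j ((thetaIndex (pilotDataOfK T.D T.K)).over v)))
      (Ψ : ℤ → ∀ v : (thetaIndex (pilotDataOfK T.D T.K)).V, v ∈ (thetaIndex (pilotDataOfK T.D T.K)).Vbad → Set ((logShellsDH (pilotDataOfK T.D T.K) (analyticLogv T.K)).StarPacket v))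
      (act : ℤ → ∀ v : (thetaIndex (pilotDataOfK T.D T.K)).V, v ∈ (thetaIndex (pilotDataOfK T.D T.K)).Vbad →
        (logShellsDH (pilotDataOfK T.D T.K) (analyticLogv T.K)).StarPacket v → Module.End ℚ ((logShellsDH (pilotDataOfK T.D T.K) (analyticLogv T.K)).StarPacket v))
      (Mmod : ℤ → ∀ j : (thetaIndex (pilotDataOfK T.D T.K)).LabelStar, Set ((logShellsDH (pilotDataOfK T.D T.K) (analyticLogv T.K)).GlobalPacket j.1))
      (region : ℤ → ∀ j : (thetaIndex (pilotDataOfK T.D T.K)).LabelStar, FinDivisor M →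
        ∀ vQ : (thetaIndex (pilotDataOfK T.D T.K)).VQ, Set ((logShellsDH (pilotDataOfK T.D T.K) (analyticLogv T.K)).Packet j.1 vQ))
      (n : ℤ) {HT : Type} {LogLink : HT → HT → Type} {IsFull : ∀ {s t : HT}, LogLink s t → Prop} (lat : LGPGaussianLogThetaLattice LogLink IsFull)
      {Frd : Type} {IsoF : Frd → Frd → Type} {Ob : Frd → Type} {realify : Frd → Frd} {Strip : Type} {IsoS : Strip → Strip → Type}
      {Mv : ∀ v : (thetaIndex (pilotDataOfK T.D T.K)).V, v ∈ (thetaIndex (pilotDataOfK T.D T.K)).Vbad → Type} [∀ v h, Monoid (Mv v h)]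
      (sig : GlobalLGPFrobenioidSignature (thetaIndex (pilotDataOfK T.D T.K)).lstar (thetaIndex (pilotDataOfK T.D T.K)).V
        (· ∈ (thetaIndex (pilotDataOfK T.D T.K)).Vbad) Frd IsoF Ob realify Strip IsoS Mv)
      (split : SplittingMonoids Mv) {ObΔ : Type} {N : ∀ v : (thetaIndex (pilotDataOfK T.D T.K)).V, v ∈ (thetaIndex (pilotDataOfK T.D T.K)).Vbad → Type}
      [∀ v h, Monoid (N v h)] (qData : QPilotData ObΔ N)
      (σ : Set (Fin (thetaIndex (pilotDataOfK T.D T.K)).lstar × (thetaIndex (pilotDataOfK T.D T.K)).VQ)) (μ₀ A : ℝ),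
      0 ≤ A → μ₀ * T.gap ≤ onTrivialMass (settingPrVolSharp (pilotDataOfK T.D T.K) (logvAnalytic_analyticLogv (F := T.K)) M archPk archSub Ψ act Mmod region n lat
            sig split qData (exists_realising_qIdeles_pilotDataOfK T.D).choose (exists_realising_thetaIdeles_pilotDataOfK T.D).choose
            (exists_realising_qIdeles_pilotDataOfK T.D).choose_spec.1 (exists_realising_qIdeles_pilotDataOfK T.D).choose_spec.2.1) σ →
        OffSigmaTolerance (1 - μ₀) A T (offTrivialMass (settingPrVolSharp (pilotDataOfK T.D T.K) (logvAnalytic_analyticLogv (F := T.K)) M archPk archSub Ψ act Mmod region n lat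
            sig split qData (exists_realising_qIdeles_pilotDataOfK T.D).choose (exists_realising_thetaIdeles_pilotDataOfK T.D).choose
            (exists_realising_qIdeles_pilotDataOfK T.D).choose_spec.1 (exists_realising_qIdeles_pilotDataOfK T.D).choose_spec.2.1) σ) := by
  intro M _ _ archPk archSub Ψ act Mmod region n HT LogLink IsFull lat Frd IsoF Ob realify Strip IsoS Mv _ sig split ObΔ N _ qData σ μ₀ A hA h
  letI := T.instFieldF; letI := T.instNumberFieldF; letI := T.instAlgebraF; letI := T.instFieldK; letI := T.instNumberFieldK
  letI := T.instAlgebraK; letI := T.instFieldFbar; letI := T.instAlgebraFbar; letI := T.instAlgebraKFbar; letI := T.instIsElliptic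
  have H := bridgeHyps_settingPrVolSharp_of_ideles (pilotDataOfK T.D T.K) (logvAnalytic_analyticLogv (F := T.K)) M archPk archSub Ψ act
    Mmod region n lat sig split qData (exists_realising_thetaIdeles_pilotDataOfK T.D).choose (exists_realising_qIdeles_pilotDataOfK T.D).choose
    (exists_realising_thetaIdeles_pilotDataOfK T.D).choose_spec.1 (exists_realising_thetaIdeles_pilotDataOfK T.D).choose_spec.2.1
    (exists_realising_qIdeles_pilotDataOfK T.D).choose_spec.1 (exists_realising_qIdeles_pilotDataOfK T.D).choose_spec.2.1
  have hg := totalTrivialMass_chosen_eq_gap T M archPk archSub Ψ act Mmod region n lat sig split qData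
  rw [offSigmaTolerance_iff, ← hg]
  rw [← hg] at h
  exact offTrivialMass_le_of_le_onTrivialMass H σ hA h

/-- **[MU-C] AT `μ₀ := μ(T)` HOLDS FOR FREE, and `0 ≤ μ(T) ≤ 1`**: with `μ(T) := mass(σ)/T.gap`, for every `A ≥ 0`,
`OffSigmaTolerance (1 − μ(T)) A T (B_triv(σᶜ))` — at each genuine datum the binder of F5 is inhabited at the datum's OWN mass fraction (so F5 per datum
reads «abc with exponent `1/μ(T)`» AS TYPED); whether `μ(T)` is bounded below uniformly on the content locus is the OPEN question (EXP-SPEC §4 / Q3).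
[claim: Mochizuki2012, status: disputed] -/
theorem offSigmaTolerance_offTrivialMass_massFrac_chosen {P : NFPoint} {l : ℕ} (T : Cor22.ThetaVolumeDatumAt P l) :
    letI := T.instFieldF; letI := T.instNumberFieldF; letI := T.instAlgebraF; letI := T.instFieldK; letI := T.instNumberFieldK; letI := T.instAlgebraK;
        letI := T.instFieldFbar; letI := T.instAlgebraFbar; letI := T.instAlgebraKFbar; letI := T.instIsElliptic;
    ∀ (M : Type) [Field M] [NumberField M]
      (archPk : ∀ (j : (thetaIndex (pilotDataOfK T.D T.K)).Label) (vQ : (thetaIndex (pilotDataOfK T.D T.K)).VQ), Set ((logShellsDH (pilotDataOfK T.D T.K) (analyticLogv T.K)).Packet j vQ))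
      (archSub : ∀ (j : (thetaIndex (pilotDataOfK T.D T.K)).Label) (v : (thetaIndex (pilotDataOfK T.D T.K)).V),
        Set ((logShellsDH (pilotDataOfK T.D T.K) (analyticLogv T.K)).Packet j ((thetaIndex (pilotDataOfK T.D T.K)).over v)))
      (Ψ : ℤ → ∀ v : (thetaIndex (pilotDataOfK T.D T.K)).V, v ∈ (thetaIndex (pilotDataOfK T.D T.K)).Vbad → Set ((logShellsDH (pilotDataOfK T.D T.K) (analyticLogv T.K)).StarPacket v))
      (act : ℤ → ∀ v : (thetaIndex (pilotDataOfK T.D T.K)).V, v ∈ (thetaIndex (pilotDataOfK T.D T.K)).Vbad →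
        (logShellsDH (pilotDataOfK T.D T.K) (analyticLogv T.K)).StarPacket v → Module.End ℚ ((logShellsDH (pilotDataOfK T.D T.K) (analyticLogv T.K)).StarPacket v))
      (Mmod : ℤ → ∀ j : (thetaIndex (pilotDataOfK T.D T.K)).LabelStar, Set ((logShellsDH (pilotDataOfK T.D T.K) (analyticLogv T.K)).GlobalPacket j.1))
      (region : ℤ → ∀ j : (thetaIndex (pilotDataOfK T.D T.K)).LabelStar, FinDivisor M →
        ∀ vQ : (thetaIndex (pilotDataOfK T.D T.K)).VQ, Set ((logShellsDH (pilotDataOfK T.D T.K) (analyticLogv T.K)).Packet j.1 vQ))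
      (n : ℤ) {HT : Type} {LogLink : HT → HT → Type} {IsFull : ∀ {s t : HT}, LogLink s t → Prop} (lat : LGPGaussianLogThetaLattice LogLink IsFull)
      {Frd : Type} {IsoF : Frd → Frd → Type} {Ob : Frd → Type} {realify : Frd → Frd} {Strip : Type} {IsoS : Strip → Strip → Type}
      {Mv : ∀ v : (thetaIndex (pilotDataOfK T.D T.K)).V, v ∈ (thetaIndex (pilotDataOfK T.D T.K)).Vbad → Type} [∀ v h, Monoid (Mv v h)]
      (sig : GlobalLGPFrobenioidSignature (thetaIndex (pilotDataOfK T.D T.K)).lstar (thetaIndex (pilotDataOfK T.D T.K)).V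
        (· ∈ (thetaIndex (pilotDataOfK T.D T.K)).Vbad) Frd IsoF Ob realify Strip IsoS Mv)
      (split : SplittingMonoids Mv) {ObΔ : Type} {N : ∀ v : (thetaIndex (pilotDataOfK T.D T.K)).V, v ∈ (thetaIndex (pilotDataOfK T.D T.K)).Vbad → Type}
      [∀ v h, Monoid (N v h)] (qData : QPilotData ObΔ N)
      (σ : Set (Fin (thetaIndex (pilotDataOfK T.D T.K)).lstar × (thetaIndex (pilotDataOfK T.D T.K)).VQ)) (A : ℝ), 0 ≤ A →
      0 ≤ onTrivialMass (settingPrVolSharp (pilotDataOfK T.D T.K) (logvAnalytic_analyticLogv (F := T.K)) M archPk archSub Ψ act Mmod region n lat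
            sig split qData (exists_realising_qIdeles_pilotDataOfK T.D).choose (exists_realising_thetaIdeles_pilotDataOfK T.D).choose
            (exists_realising_qIdeles_pilotDataOfK T.D).choose_spec.1 (exists_realising_qIdeles_pilotDataOfK T.D).choose_spec.2.1) σ / T.gap ∧
        onTrivialMass (settingPrVolSharp (pilotDataOfK T.D T.K) (logvAnalytic_analyticLogv (F := T.K)) M archPk archSub Ψ act Mmod region n lat
            sig split qData (exists_realising_qIdeles_pilotDataOfK T.D).choose (exists_realising_thetaIdeles_pilotDataOfK T.D).choose
            (exists_realising_qIdeles_pilotDataOfK T.D).choose_spec.1 (exists_realising_qIdeles_pilotDataOfK T.D).choose_spec.2.1) σ / T.gap ≤ 1 ∧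
        OffSigmaTolerance (1 - onTrivialMass (settingPrVolSharp (pilotDataOfK T.D T.K) (logvAnalytic_analyticLogv (F := T.K)) M archPk archSub Ψ act Mmod region n lat
            sig split qData (exists_realising_qIdeles_pilotDataOfK T.D).choose (exists_realising_thetaIdeles_pilotDataOfK T.D).choose
            (exists_realising_qIdeles_pilotDataOfK T.D).choose_spec.1 (exists_realising_qIdeles_pilotDataOfK T.D).choose_spec.2.1) σ / T.gap) A T
          (offTrivialMass (settingPrVolSharp (pilotDataOfK T.D T.K) (logvAnalytic_analyticLogv (F := T.K)) M archPk archSub Ψ act Mmod region n lat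
            sig split qData (exists_realising_qIdeles_pilotDataOfK T.D).choose (exists_realising_thetaIdeles_pilotDataOfK T.D).choose
            (exists_realising_qIdeles_pilotDataOfK T.D).choose_spec.1 (exists_realising_qIdeles_pilotDataOfK T.D).choose_spec.2.1) σ) := by
  intro M _ _ archPk archSub Ψ act Mmod region n HT LogLink IsFull lat Frd IsoF Ob realify Strip IsoS Mv _ sig split ObΔ N _ qData σ A hA
  letI := T.instFieldF; letI := T.instNumberFieldF; letI := T.instAlgebraF; letI := T.instFieldK; letI := T.instNumberFieldK
  letI := T.instAlgebraK; letI := T.instFieldFbar; letI := T.instAlgebraFbar; letI := T.instAlgebraKFbar; letI := T.instIsElliptic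
  have H := bridgeHyps_settingPrVolSharp_of_ideles (pilotDataOfK T.D T.K) (logvAnalytic_analyticLogv (F := T.K)) M archPk archSub Ψ act
    Mmod region n lat sig split qData (exists_realising_thetaIdeles_pilotDataOfK T.D).choose (exists_realising_qIdeles_pilotDataOfK T.D).choose
    (exists_realising_thetaIdeles_pilotDataOfK T.D).choose_spec.1 (exists_realising_thetaIdeles_pilotDataOfK T.D).choose_spec.2.1
    (exists_realising_qIdeles_pilotDataOfK T.D).choose_spec.1 (exists_realising_qIdeles_pilotDataOfK T.D).choose_spec.2.1
  rw [offSigmaTolerance_iff, ← totalTrivialMass_chosen_eq_gap T M archPk archSub Ψ act Mmod region n lat sig split qData]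
  exact ⟨onTrivialMass_div_totalTrivialMass_nonneg σ, onTrivialMass_div_totalTrivialMass_le_one H σ, offTrivialMass_le_massFrac H σ hA⟩

/-- **THE `σ = ∅` JUNK BAND**: `OffSigmaTolerance (1−μ₀) A T (B_triv(∅ᶜ)) ⟺ μ₀·T.gap ≤ A` (`B_triv(∅ᶜ) = M = T.gap`). With `A = Tol(P,l) = ((l+1)/4)·5·d*·l`
and `T.gap = ((l+1)/24 − 1/(2l))·log(q^{∤{2,l}})` (`PointDict.gap_eq`): the EMPTY stratum passes [MU-C] exactly on the bounded-height band
`μ₀·((l+1)/24 − 1/(2l))·log q ≤ Tol` — abc-iut-rh2-ref-3's «μ₀-family sanity» (2026-08-27T00:56:16Z) in kernel, so that no small-`μ₀` instance of F5 is read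
as licence content. [claim: Mochizuki2012, status: disputed] -/
theorem offSigmaTolerance_offTrivialMass_empty_iff_chosen {P : NFPoint} {l : ℕ} (T : Cor22.ThetaVolumeDatumAt P l) :
    letI := T.instFieldF; letI := T.instNumberFieldF; letI := T.instAlgebraF; letI := T.instFieldK; letI := T.instNumberFieldK; letI := T.instAlgebraK;
        letI := T.instFieldFbar; letI := T.instAlgebraFbar; letI := T.instAlgebraKFbar; letI := T.instIsElliptic;
    ∀ (M : Type) [Field M] [NumberField M]
      (archPk : ∀ (j : (thetaIndex (pilotDataOfK T.D T.K)).Label) (vQ : (thetaIndex (pilotDataOfK T.D T.K)).VQ), Set ((logShellsDH (pilotDataOfK T.D T.K) (analyticLogv T.K)).Packet j vQ))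
      (archSub : ∀ (j : (thetaIndex (pilotDataOfK T.D T.K)).Label) (v : (thetaIndex (pilotDataOfK T.D T.K)).V),
        Set ((logShellsDH (pilotDataOfK T.D T.K) (analyticLogv T.K)).Packet j ((thetaIndex (pilotDataOfK T.D T.K)).over v)))
      (Ψ : ℤ → ∀ v : (thetaIndex (pilotDataOfK T.D T.K)).V, v ∈ (thetaIndex (pilotDataOfK T.D T.K)).Vbad → Set ((logShellsDH (pilotDataOfK T.D T.K) (analyticLogv T.K)).StarPacket v))
      (act : ℤ → ∀ v : (thetaIndex (pilotDataOfK T.D T.K)).V, v ∈ (thetaIndex (pilotDataOfK T.D T.K)).Vbad →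
        (logShellsDH (pilotDataOfK T.D T.K) (analyticLogv T.K)).StarPacket v → Module.End ℚ ((logShellsDH (pilotDataOfK T.D T.K) (analyticLogv T.K)).StarPacket v))
      (Mmod : ℤ → ∀ j : (thetaIndex (pilotDataOfK T.D T.K)).LabelStar, Set ((logShellsDH (pilotDataOfK T.D T.K) (analyticLogv T.K)).GlobalPacket j.1))
      (region : ℤ → ∀ j : (thetaIndex (pilotDataOfK T.D T.K)).LabelStar, FinDivisor M →
        ∀ vQ : (thetaIndex (pilotDataOfK T.D T.K)).VQ, Set ((logShellsDH (pilotDataOfK T.D T.K) (analyticLogv T.K)).Packet j.1 vQ))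
      (n : ℤ) {HT : Type} {LogLink : HT → HT → Type} {IsFull : ∀ {s t : HT}, LogLink s t → Prop} (lat : LGPGaussianLogThetaLattice LogLink IsFull)
      {Frd : Type} {IsoF : Frd → Frd → Type} {Ob : Frd → Type} {realify : Frd → Frd} {Strip : Type} {IsoS : Strip → Strip → Type}
      {Mv : ∀ v : (thetaIndex (pilotDataOfK T.D T.K)).V, v ∈ (thetaIndex (pilotDataOfK T.D T.K)).Vbad → Type} [∀ v h, Monoid (Mv v h)]
      (sig : GlobalLGPFrobenioidSignature (thetaIndex (pilotDataOfK T.D T.K)).lstar (thetaIndex (pilotDataOfK T.D T.K)).V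
        (· ∈ (thetaIndex (pilotDataOfK T.D T.K)).Vbad) Frd IsoF Ob realify Strip IsoS Mv)
      (split : SplittingMonoids Mv) {ObΔ : Type} {N : ∀ v : (thetaIndex (pilotDataOfK T.D T.K)).V, v ∈ (thetaIndex (pilotDataOfK T.D T.K)).Vbad → Type}
      [∀ v h, Monoid (N v h)] (qData : QPilotData ObΔ N)
      (μ₀ A : ℝ), OffSigmaTolerance (1 - μ₀) A T (offTrivialMass (settingPrVolSharp (pilotDataOfK T.D T.K) (logvAnalytic_analyticLogv (F := T.K)) M archPk archSub Ψ act Mmod region n lat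
            sig split qData (exists_realising_qIdeles_pilotDataOfK T.D).choose (exists_realising_thetaIdeles_pilotDataOfK T.D).choose
            (exists_realising_qIdeles_pilotDataOfK T.D).choose_spec.1 (exists_realising_qIdeles_pilotDataOfK T.D).choose_spec.2.1) ∅) ↔ μ₀ * T.gap ≤ A := by
  intro M _ _ archPk archSub Ψ act Mmod region n HT LogLink IsFull lat Frd IsoF Ob realify Strip IsoS Mv _ sig split ObΔ N _ qData μ₀ A
  letI := T.instFieldF; letI := T.instNumberFieldF; letI := T.instAlgebraF; letI := T.instFieldK; letI := T.instNumberFieldK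
  letI := T.instAlgebraK; letI := T.instFieldFbar; letI := T.instAlgebraFbar; letI := T.instAlgebraKFbar; letI := T.instIsElliptic
  rw [offSigmaTolerance_iff, offTrivialMass_empty, totalTrivialMass_chosen_eq_gap T M archPk archSub Ψ act Mmod region n lat sig split qData]
  have e : (1 - μ₀) * T.gap + A = T.gap - μ₀ * T.gap + A := by ring
  rw [e]
  constructor <;> intro h <;> linarith

/-- **`mass(Σ_data)` EXPLICIT AS A PLACE SUM (the NUMERATOR of `μ(T)`)**: for a stratum `σ` meeting every packet `v_ℚ` exactly in the labels `j = i+1 ≤ j₀(v_ℚ)`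
(`j₀ ≤ l⋇`; every kept row's slice, `plan/rescue/R-H/SLICE.md` / R15), `mass(σ) = (1/l⋇)·Σᶠ_{v_ℚ} S(j₀(v_ℚ))·h(v_ℚ)` at the datum — hence
**`μ(T) = mass(σ)/T.gap = Σ_p S(j₀(p))·h_p / (S(l⋇)·Σ_p h_p)`**, EXP-SPEC §0's formula (`RHSigmaMassMu.onTrivialMass_settingPrVolSharp_labelSegment_eq`).
[cite: Mochizuki2012, IUTchIII Prop. 3.9 (i)–(iii) p. 116–117; IUTchIV Thm. 1.10 Step (v) p. 27–29] [claim: Mochizuki2012, status: disputed] -/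
theorem onTrivialMass_chosen_labelSegment_eq {P : NFPoint} {l : ℕ} (T : Cor22.ThetaVolumeDatumAt P l) :
    letI := T.instFieldF; letI := T.instNumberFieldF; letI := T.instAlgebraF; letI := T.instFieldK; letI := T.instNumberFieldK; letI := T.instAlgebraK;
        letI := T.instFieldFbar; letI := T.instAlgebraFbar; letI := T.instAlgebraKFbar; letI := T.instIsElliptic;
    ∀ (M : Type) [Field M] [NumberField M]
      (archPk : ∀ (j : (thetaIndex (pilotDataOfK T.D T.K)).Label) (vQ : (thetaIndex (pilotDataOfK T.D T.K)).VQ), Set ((logShellsDH (pilotDataOfK T.D T.K) (analyticLogv T.K)).Packet j vQ))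
      (archSub : ∀ (j : (thetaIndex (pilotDataOfK T.D T.K)).Label) (v : (thetaIndex (pilotDataOfK T.D T.K)).V),
        Set ((logShellsDH (pilotDataOfK T.D T.K) (analyticLogv T.K)).Packet j ((thetaIndex (pilotDataOfK T.D T.K)).over v)))
      (Ψ : ℤ → ∀ v : (thetaIndex (pilotDataOfK T.D T.K)).V, v ∈ (thetaIndex (pilotDataOfK T.D T.K)).Vbad → Set ((logShellsDH (pilotDataOfK T.D T.K) (analyticLogv T.K)).StarPacket v))
      (act : ℤ → ∀ v : (thetaIndex (pilotDataOfK T.D T.K)).V, v ∈ (thetaIndex (pilotDataOfK T.D T.K)).Vbad →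
        (logShellsDH (pilotDataOfK T.D T.K) (analyticLogv T.K)).StarPacket v → Module.End ℚ ((logShellsDH (pilotDataOfK T.D T.K) (analyticLogv T.K)).StarPacket v))
      (Mmod : ℤ → ∀ j : (thetaIndex (pilotDataOfK T.D T.K)).LabelStar, Set ((logShellsDH (pilotDataOfK T.D T.K) (analyticLogv T.K)).GlobalPacket j.1))
      (region : ℤ → ∀ j : (thetaIndex (pilotDataOfK T.D T.K)).LabelStar, FinDivisor M →
        ∀ vQ : (thetaIndex (pilotDataOfK T.D T.K)).VQ, Set ((logShellsDH (pilotDataOfK T.D T.K) (analyticLogv T.K)).Packet j.1 vQ))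
      (n : ℤ) {HT : Type} {LogLink : HT → HT → Type} {IsFull : ∀ {s t : HT}, LogLink s t → Prop} (lat : LGPGaussianLogThetaLattice LogLink IsFull)
      {Frd : Type} {IsoF : Frd → Frd → Type} {Ob : Frd → Type} {realify : Frd → Frd} {Strip : Type} {IsoS : Strip → Strip → Type}
      {Mv : ∀ v : (thetaIndex (pilotDataOfK T.D T.K)).V, v ∈ (thetaIndex (pilotDataOfK T.D T.K)).Vbad → Type} [∀ v h, Monoid (Mv v h)]
      (sig : GlobalLGPFrobenioidSignature (thetaIndex (pilotDataOfK T.D T.K)).lstar (thetaIndex (pilotDataOfK T.D T.K)).V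
        (· ∈ (thetaIndex (pilotDataOfK T.D T.K)).Vbad) Frd IsoF Ob realify Strip IsoS Mv)
      (split : SplittingMonoids Mv) {ObΔ : Type} {N : ∀ v : (thetaIndex (pilotDataOfK T.D T.K)).V, v ∈ (thetaIndex (pilotDataOfK T.D T.K)).Vbad → Type}
      [∀ v h, Monoid (N v h)] (qData : QPilotData ObΔ N)
      (j₀ : (thetaIndex (pilotDataOfK T.D T.K)).VQ → ℕ) (_ : ∀ vQ, j₀ vQ ≤ (pilotDataOfK T.D T.K).lstar)
      (σ : Set (Fin (thetaIndex (pilotDataOfK T.D T.K)).lstar × (thetaIndex (pilotDataOfK T.D T.K)).VQ))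
      (_ : ∀ (i : Fin (thetaIndex (pilotDataOfK T.D T.K)).lstar) (vQ : (thetaIndex (pilotDataOfK T.D T.K)).VQ), (i, vQ) ∈ σ ↔ (i : ℕ) + 1 ≤ j₀ vQ),
      onTrivialMass (settingPrVolSharp (pilotDataOfK T.D T.K) (logvAnalytic_analyticLogv (F := T.K)) M archPk archSub Ψ act Mmod region n lat
            sig split qData (exists_realising_qIdeles_pilotDataOfK T.D).choose (exists_realising_thetaIdeles_pilotDataOfK T.D).choose
            (exists_realising_qIdeles_pilotDataOfK T.D).choose_spec.1 (exists_realising_qIdeles_pilotDataOfK T.D).choose_spec.2.1) σ =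
        (∑ᶠ vQ : (thetaIndex (pilotDataOfK T.D T.K)).VQ, (j₀ vQ : ℝ) * (j₀ vQ - 1) * (2 * j₀ vQ + 5) / 6 *
          Sum.elim (fun _ : Unit => (0 : ℝ))
            (fun pp : Nat.Primes => (∑ v ∈ placesOver T.K pp, (pilotDataOfK T.D T.K).qPilot v * logNorm T.K v) / Module.finrank ℚ T.K) vQ) /
        (pilotDataOfK T.D T.K).lstar := by
  intro M _ _ archPk archSub Ψ act Mmod region n HT LogLink IsFull lat Frd IsoF Ob realify Strip IsoS Mv _ sig split ObΔ N _ qData j₀ hj σ hσ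
  letI := T.instFieldF; letI := T.instNumberFieldF; letI := T.instAlgebraF; letI := T.instFieldK; letI := T.instNumberFieldK
  letI := T.instAlgebraK; letI := T.instFieldFbar; letI := T.instAlgebraFbar; letI := T.instAlgebraKFbar; letI := T.instIsElliptic
  exact onTrivialMass_settingPrVolSharp_labelSegment_eq (pilotDataOfK T.D T.K) (logvAnalytic_analyticLogv (F := T.K))
    M archPk archSub Ψ act Mmod region n lat sig split qData (exists_realising_qIdeles_pilotDataOfK T.D).choose
    (exists_realising_thetaIdeles_pilotDataOfK T.D).choose (exists_realising_qIdeles_pilotDataOfK T.D).choose_spec.1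
    (exists_realising_qIdeles_pilotDataOfK T.D).choose_spec.2.1 (exists_realising_thetaIdeles_pilotDataOfK T.D).choose_spec.1
    (exists_realising_thetaIdeles_pilotDataOfK T.D).choose_spec.2.2 (exists_realising_qIdeles_pilotDataOfK T.D).choose_spec.2.2 hj σ hσ

/-- **THE DEPTH CERTIFICATE FOR [MU-C]: a UNIFORM LICENSED DEPTH `J` gives `μ₀ := S(J)/S(l⋇)`.** If the stratum `σ` contains the cells `(i, p)`, `i + 1 ≤ J ≤ l⋇`,
at every prime packet `p` of non-zero place weight `h(p)` (the packets over the bad places; all others weigh `0`), then for every `A ≥ 0`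
`OffSigmaTolerance (1 − S(J)/S(l⋇)) A T (B_triv(σᶜ))` — i.e. F5's [MU-C] holds at the datum with `μ₀ = S(J)/S(l⋇) ≥ ((J−1)/(l⋇+1))³`
(`RHSigmaMassMu.sqSubOneSum_mul_pilotGap_le_onTrivialMass_of_segment_subset`, `sqSubOneSum_frac_ge_cubic`). READING: «every bad place licensed up to label `J`»
is what a row's `Σ_data` with `min_w j₀(w) ≥ J` supplies (SLICE.md); `J = l⋇` ⟹ `μ₀ = 1` (ABC itself, `abcWithExponent_one_iff` of F1). [claim: Mochizuki2012, status: disputed] -/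
theorem offSigmaTolerance_offTrivialMass_of_segment_subset_chosen {P : NFPoint} {l : ℕ} (T : Cor22.ThetaVolumeDatumAt P l) :
    letI := T.instFieldF; letI := T.instNumberFieldF; letI := T.instAlgebraF; letI := T.instFieldK; letI := T.instNumberFieldK; letI := T.instAlgebraK;
        letI := T.instFieldFbar; letI := T.instAlgebraFbar; letI := T.instAlgebraKFbar; letI := T.instIsElliptic;
    ∀ (M : Type) [Field M] [NumberField M]
      (archPk : ∀ (j : (thetaIndex (pilotDataOfK T.D T.K)).Label) (vQ : (thetaIndex (pilotDataOfK T.D T.K)).VQ), Set ((logShellsDH (pilotDataOfK T.D T.K) (analyticLogv T.K)).Packet j vQ))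
      (archSub : ∀ (j : (thetaIndex (pilotDataOfK T.D T.K)).Label) (v : (thetaIndex (pilotDataOfK T.D T.K)).V),
        Set ((logShellsDH (pilotDataOfK T.D T.K) (analyticLogv T.K)).Packet j ((thetaIndex (pilotDataOfK T.D T.K)).over v)))
      (Ψ : ℤ → ∀ v : (thetaIndex (pilotDataOfK T.D T.K)).V, v ∈ (thetaIndex (pilotDataOfK T.D T.K)).Vbad → Set ((logShellsDH (pilotDataOfK T.D T.K) (analyticLogv T.K)).StarPacket v))
      (act : ℤ → ∀ v : (thetaIndex (pilotDataOfK T.D T.K)).V, v ∈ (thetaIndex (pilotDataOfK T.D T.K)).Vbad →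
        (logShellsDH (pilotDataOfK T.D T.K) (analyticLogv T.K)).StarPacket v → Module.End ℚ ((logShellsDH (pilotDataOfK T.D T.K) (analyticLogv T.K)).StarPacket v))
      (Mmod : ℤ → ∀ j : (thetaIndex (pilotDataOfK T.D T.K)).LabelStar, Set ((logShellsDH (pilotDataOfK T.D T.K) (analyticLogv T.K)).GlobalPacket j.1))
      (region : ℤ → ∀ j : (thetaIndex (pilotDataOfK T.D T.K)).LabelStar, FinDivisor M →
        ∀ vQ : (thetaIndex (pilotDataOfK T.D T.K)).VQ, Set ((logShellsDH (pilotDataOfK T.D T.K) (analyticLogv T.K)).Packet j.1 vQ))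
      (n : ℤ) {HT : Type} {LogLink : HT → HT → Type} {IsFull : ∀ {s t : HT}, LogLink s t → Prop} (lat : LGPGaussianLogThetaLattice LogLink IsFull)
      {Frd : Type} {IsoF : Frd → Frd → Type} {Ob : Frd → Type} {realify : Frd → Frd} {Strip : Type} {IsoS : Strip → Strip → Type}
      {Mv : ∀ v : (thetaIndex (pilotDataOfK T.D T.K)).V, v ∈ (thetaIndex (pilotDataOfK T.D T.K)).Vbad → Type} [∀ v h, Monoid (Mv v h)]
      (sig : GlobalLGPFrobenioidSignature (thetaIndex (pilotDataOfK T.D T.K)).lstar (thetaIndex (pilotDataOfK T.D T.K)).V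
        (· ∈ (thetaIndex (pilotDataOfK T.D T.K)).Vbad) Frd IsoF Ob realify Strip IsoS Mv)
      (split : SplittingMonoids Mv) {ObΔ : Type} {N : ∀ v : (thetaIndex (pilotDataOfK T.D T.K)).V, v ∈ (thetaIndex (pilotDataOfK T.D T.K)).Vbad → Type}
      [∀ v h, Monoid (N v h)] (qData : QPilotData ObΔ N)
      (J : ℕ) (_ : J ≤ (pilotDataOfK T.D T.K).lstar)
      (σ : Set (Fin (thetaIndex (pilotDataOfK T.D T.K)).lstar × (thetaIndex (pilotDataOfK T.D T.K)).VQ))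
      (_ : ∀ (i : Fin (thetaIndex (pilotDataOfK T.D T.K)).lstar) (pp : Nat.Primes),
        (∑ v ∈ placesOver T.K pp, (pilotDataOfK T.D T.K).qPilot v * logNorm T.K v) / Module.finrank ℚ T.K ≠ 0 → (i : ℕ) + 1 ≤ J →
          (i, Sum.inr pp) ∈ σ)
      (A : ℝ), 0 ≤ A →
      OffSigmaTolerance
        (1 - ((J : ℝ) * (J - 1) * (2 * J + 5) / 6) /
          (((pilotDataOfK T.D T.K).lstar : ℝ) * ((pilotDataOfK T.D T.K).lstar - 1) * (2 * (pilotDataOfK T.D T.K).lstar + 5) / 6))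
        A T (offTrivialMass (settingPrVolSharp (pilotDataOfK T.D T.K) (logvAnalytic_analyticLogv (F := T.K)) M archPk archSub Ψ act Mmod region n lat
            sig split qData (exists_realising_qIdeles_pilotDataOfK T.D).choose (exists_realising_thetaIdeles_pilotDataOfK T.D).choose
            (exists_realising_qIdeles_pilotDataOfK T.D).choose_spec.1 (exists_realising_qIdeles_pilotDataOfK T.D).choose_spec.2.1) σ) := by
  intro M _ _ archPk archSub Ψ act Mmod region n HT LogLink IsFull lat Frd IsoF Ob realify Strip IsoS Mv _ sig split ObΔ N _ qData J hJ σ hσ A hA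
  letI := T.instFieldF; letI := T.instNumberFieldF; letI := T.instAlgebraF; letI := T.instFieldK; letI := T.instNumberFieldK
  letI := T.instAlgebraK; letI := T.instFieldFbar; letI := T.instAlgebraFbar; letI := T.instAlgebraKFbar; letI := T.instIsElliptic
  have H := bridgeHyps_settingPrVolSharp_of_ideles (pilotDataOfK T.D T.K) (logvAnalytic_analyticLogv (F := T.K)) M archPk archSub Ψ act
    Mmod region n lat sig split qData (exists_realising_thetaIdeles_pilotDataOfK T.D).choose (exists_realising_qIdeles_pilotDataOfK T.D).choose
    (exists_realising_thetaIdeles_pilotDataOfK T.D).choose_spec.1 (exists_realising_thetaIdeles_pilotDataOfK T.D).choose_spec.2.1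
    (exists_realising_qIdeles_pilotDataOfK T.D).choose_spec.1 (exists_realising_qIdeles_pilotDataOfK T.D).choose_spec.2.1
  have hg := totalTrivialMass_chosen_eq_gap T M archPk archSub Ψ act Mmod region n lat sig split qData
  have hM := totalTrivialMass_settingPrVolSharp_eq_pilotGap (pilotDataOfK T.D T.K) (logvAnalytic_analyticLogv (F := T.K))
    M archPk archSub Ψ act Mmod region n lat sig split qData (exists_realising_qIdeles_pilotDataOfK T.D).choose
    (exists_realising_thetaIdeles_pilotDataOfK T.D).choose (exists_realising_qIdeles_pilotDataOfK T.D).choose_spec.1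
    (exists_realising_qIdeles_pilotDataOfK T.D).choose_spec.2.1 (exists_realising_thetaIdeles_pilotDataOfK T.D).choose_spec.1
    (exists_realising_thetaIdeles_pilotDataOfK T.D).choose_spec.2.2 (exists_realising_qIdeles_pilotDataOfK T.D).choose_spec.2.2
  have hle := sqSubOneSum_mul_pilotGap_le_onTrivialMass_of_segment_subset (pilotDataOfK T.D T.K) (logvAnalytic_analyticLogv (F := T.K))
    M archPk archSub Ψ act Mmod region n lat sig split qData (exists_realising_qIdeles_pilotDataOfK T.D).choose
    (exists_realising_thetaIdeles_pilotDataOfK T.D).choose (exists_realising_qIdeles_pilotDataOfK T.D).choose_spec.1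
    (exists_realising_qIdeles_pilotDataOfK T.D).choose_spec.2.1 (exists_realising_thetaIdeles_pilotDataOfK T.D).choose_spec.1
    (exists_realising_thetaIdeles_pilotDataOfK T.D).choose_spec.2.2 (exists_realising_qIdeles_pilotDataOfK T.D).choose_spec.2.2 hJ σ hσ
  rw [← hM, hg] at hle
  rw [offSigmaTolerance_iff, ← hg]
  rw [← hg] at hle
  refine offTrivialMass_le_of_le_onTrivialMass H σ hA ?_
  have hSpos : (0 : ℝ) < ((pilotDataOfK T.D T.K).lstar : ℝ) * ((pilotDataOfK T.D T.K).lstar - 1) * (2 * (pilotDataOfK T.D T.K).lstar + 5) / 6 :=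
    sqSubOneSum_pos (thetaIndex (pilotDataOfK T.D T.K)).two_le_lstar
  rw [div_mul_eq_mul_div, div_le_iff₀ hSpos]
  linarith

end Datum

end Summit.ABC.IUTFork.Repair.RH.CellWeights

end
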